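import Summits.ValiantsHypothesis.ValiantsHypothesis.Theorems.BarrierLeverAnchoredDoorHitsLowerPairsUQFaceSpecTwo
import Summits.ValiantsHypothesis.ValiantsHypothesis.Theorems.BarrierLeverAnchoredDoorHitsLowerPairsGapOneFace
import Summits.ValiantsHypothesis.ValiantsHypothesis.Theorems.BarrierLeverAnchoredDoorHitsLowerPairsUQFacePrelim
import Summits.ValiantsHypothesis.ValiantsHypothesis.Theorems.BarrierLeverAnchoredDoorHitsLowerPairsBlockPairingBasis

/-!
# Support item `AnchoredDoorHitsLowerPairs` (stmt-ValiantsHypothesis-22510), line `anchored-peeling`: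
# THE GENERAL-GAP FACE-TARGET UQ² STEP (pair-distinct private anchors) — core theorem with explicit reindexings

Helper file (`--supports stmt-ValiantsHypothesis-22510`; cell valiant-natproofs, rung V4, 𝒟-side door (c); registered line
`Cruxes/AnchoredDoorHitsLowerPairs/Lines/anchored_peeling.lean` v13, composition `Stmt.stub_uqFaceStep → Stmt.stub_uqFaceResidual → crux`;
prover seat val-np-p1 gen 20). Closes NO item; STRENGTHENS `symbolicDet_ne_zero_of_uqFaceCore` (p626081): the roots `ρ k` need not be distinct —
only the PAIRS `(ρ k, F k)` must be, where `F k` is a sub-target with `F₀ ⊆ F k ⊆ w j_k`, `|F k| ≤ s` (`j_k` the matched deleted column). Same proof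
(two anchors of the private set both carry `y_{F₀}`, so no mixed terms: `…UQFaceSpecTwo`). Sequel: `…UQ2FaceStep` (stub text + assembly).

THEOREM `symbolicDet_ne_zero_of_uqFaceCore₂`. Layout `(u, w)` injective; `a` an `x`-vertex; target face `F₀ = {c} ∪ D`, `|F₀| ≤ s`. Peel `a ↦ (a | F)`
(`facePeelMatrix`, file `…GapOneFace`): LINK rows `p i :⟺ a ∈ u i` vanish on the columns `q j :⟺ F ⊄ w j`. Data: a splitting
`e : {i // ¬ p i} ≃ Fin n ⊕ κ` of the deletion rows into KEPT rows and DELETED rows (the up-set `𝒜 = {u i_k}`: no kept row contains a deleted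
face — `hup`), ROOTS `ρ k ⊆ u i_k` with `1 ≤ |ρ k| ≤ s` and SUB-TARGETS `F₀ ⊆ F k ⊆ w j_k` with `|F k| ≤ s`, the pairs `(ρ k, F k)` injective in `k`, a splitting `e' : {j // ¬ q j} ≃ Fin n' ⊕ κ` of the `F`-columns into kept and
deleted ones (SAME index type `κ`: the gap), `eQ : {j // q j} ≃ Fin n`, `eP : {i // p i} ≃ Fin n'`, and the two core minors: (H1) the kept deletion
rows against the `q`-columns, (H2) the link rows against the kept `F`-columns (faces `u i ∖ a`, `w j ∖ F`). Conclusion: `symbolicDet s h r u w ≠ 0`.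

PROOF. Specialise the private anchors `α_k = (ρ k | F k)` by `wSpecHom` (file `…UQFaceSpecTwo`) with twist sets `P α_k = u i_k ∖ ρ k`, `Q α_k = w j_k ∖ F k`
(`j_k` = the k-th DELETED column — the targets are the deleted columns' faces) and weights `wt α_k = (Λ + |u i_k|) · ∏_{k' ≠ k} N_{k'}`,
`N_k = |P α_k| + |Q α_k| + 1`, `Λ = h · Σ N + 1`. By `det_ne_zero_of_blockPairing_basis` (p621324) with the cofactor families `ν_k` (rows, `…CofactorBasis`
p621668, spanning because of (H1)) and `β_l` (columns, the same construction on the transpose, kernel vectors because of (H2)) it suffices that the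
`κ × κ` cross matrix `P k l = ν_k ⬝ G′ β_l` is nonsingular. Row `k` of `P` has `T`-degree `≤ d_k = wt α_k · N_k`: a kept row never contains a full
deleted face (up-set), a deleted face inside `u i_k` other than itself is strictly smaller (`|·|` smaller ⇒ weighted degree smaller), and partial twist
sets lose at least `wt`; the coefficient of `T^{d_k}` in `P k l` is `ν_k(i_k) · L°[∅, w j ∖ w j_k]-sum · β_l = ν_k(i_k) β_l(j_k) = [k = l] · (± det K)(± det K′)`.
So the top matrix is DIAGONAL with nonzero diagonal and `coeff_det_of_natDegree_le_row` (file `…StarSpec`) gives `det P ≠ 0`.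

WHAT THIS IS NOT: no claim on the residual stub; nothing on crux stmt-ValiantsHypothesis-14610 or on `VP` versus `VNP`.
-/

set_option linter.dupNamespace false

open Matrix

namespace Summit.ValiantsHypothesis.ValiantsHypothesis.Theorems.BarrierLever.AnchoredPeeling

open Finset MvPolynomial
open Summit.ValiantsHypothesis.ValiantsHypothesis.Theorems.BarrierLever.BrickCalculus (pexpo pexpo_def pexpo_le_iff pexpo_sub)

noncomputable section

/-! ## The core theorem -/

variable {s h r : ℕ} {u w : Fin r → Finset (Fin h)} {a c : Fin h} {D : Finset (Fin h)}

/-- **THE GENERAL-GAP FACE-TARGET UQ STEP (core form).** See the module docstring. -/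
theorem symbolicDet_ne_zero_of_uqFaceCore₂ (hs : 1 ≤ s) (hu : Function.Injective u) (hw : Function.Injective w)
    (hcD : c ∉ D) {F₀ : Finset (Fin h)} (hFD : insert c D = F₀) {n n' : ℕ} {κ : Type} [Fintype κ] [DecidableEq κ]
    (e : {i : Fin r // ¬ (a ∈ u i)} ≃ Fin n ⊕ κ) (eQ : {j : Fin r // ¬ (F₀ ⊆ w j)} ≃ Fin n)
    (eP : {i : Fin r // a ∈ u i} ≃ Fin n') (e' : {j : Fin r // ¬ ¬ (F₀ ⊆ w j)} ≃ Fin n' ⊕ κ)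
    (hup : ∀ k x, ¬ (u (e.symm (Sum.inr k)).1 ⊆ u (e.symm (Sum.inl x)).1))
    (ρ : κ → Finset (Fin h)) (hρ : ∀ k, ρ k ⊆ u (e.symm (Sum.inr k)).1 ∧ 1 ≤ (ρ k).card ∧ (ρ k).card ≤ s)
    (Fk : κ → Finset (Fin h)) (hFk : ∀ k, F₀ ⊆ Fk k ∧ Fk k ⊆ w (e'.symm (Sum.inr k)).1 ∧ (Fk k).card ≤ s)
    (hαinj : Function.Injective (fun k => (ρ k, Fk k)))
    (H1 : (Matrix.of fun x y : Fin n =>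
      coeff (pexpo (u (e.symm (Sum.inl x)).1) (w (eQ.symm y).1)) (symbolicWitness s h)).det ≠ 0)
    (H2 : (Matrix.of fun x y : Fin n' =>
      coeff (pexpo ((u (eP.symm x).1).erase a) (w (e'.symm (Sum.inl y)).1 \ F₀)) (symbolicWitness s h)).det ≠ 0) :
    symbolicDet s h r u w ≠ 0 := by
  classical
  subst hFD
  -- names
  let F : Finset (Fin h) := insert c D
  have hcF : c ∈ F := Finset.mem_insert_self c D
  have hFne : F.Nonempty := ⟨c, hcF⟩
  let p : Fin r → Prop := fun i => a ∈ u i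
  let q : Fin r → Prop := fun j => ¬ (F ⊆ w j)
  let G : Matrix (Fin r) (Fin r) (MvPolynomial (Param h) ℂ) := facePeelMatrix s h r u w a c D
  let iκ : κ → Fin r := fun k => (e.symm (Sum.inr k)).1
  let jκ : κ → Fin r := fun k => (e'.symm (Sum.inr k)).1
  have hiκ : ∀ k, a ∉ u (iκ k) := fun k => (e.symm (Sum.inr k)).2
  have hjκ : ∀ k, F ⊆ w (jκ k) := fun k => not_not.mp (e'.symm (Sum.inr k)).2
  have hiκ_inj : Function.Injective iκ := fun k k' hkk =>
    Sum.inr_injective (e.symm.injective (Subtype.ext hkk))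
  have hjκ_inj : Function.Injective jκ := fun k k' hkk =>
    Sum.inr_injective (e'.symm.injective (Subtype.ext hkk))
  let Af : κ → Finset (Fin h) := fun k => u (iκ k)
  let Bf : κ → Finset (Fin h) := fun k => w (jκ k)
  have hAinj : Function.Injective Af := fun k k' hkk => hiκ_inj (hu hkk)
  -- anchors
  let ακ : κ → Finset (Fin h) × Finset (Fin h) := fun k => (ρ k, Fk k)
  let 𝔅 : Finset (Finset (Fin h) × Finset (Fin h)) := Finset.univ.image ακ
  have hmem𝔅 : ∀ {α}, α ∈ 𝔅 ↔ ∃ k, ακ k = α := fun {α} => by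
    simp only [𝔅, Finset.mem_image, Finset.mem_univ, true_and]
  have hακ𝔅 : ∀ k, ακ k ∈ 𝔅 := fun k => hmem𝔅.mpr ⟨k, rfl⟩
  have h𝔅 : 𝔅 ⊆ anchors s h := by
    intro α hα
    obtain ⟨k, rfl⟩ := hmem𝔅.mp hα
    rw [anchors, Finset.mem_filter]
    refine ⟨Finset.mem_univ _, (hρ k).2.1, (hρ k).2.2, Finset.card_pos.mpr ⟨c, (hFk k).1 hcF⟩, (hFk k).2.2⟩
  have h2 : ∀ α ∈ 𝔅, F ⊆ α.2 := fun α hα => by obtain ⟨k, rfl⟩ := hmem𝔅.mp hα; exact (hFk k).1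
  -- twist sets and weights, as functions on anchors
  let N : κ → ℕ := fun k => (Af k \ ρ k).card + (Bf k \ Fk k).card + 1
  have hN : ∀ k, 1 ≤ N k := fun k => Nat.succ_le_succ (Nat.zero_le _)
  let cA : κ → ℕ := fun k => (Af k).card
  have hcA : ∀ k, cA k ≤ h := fun k => (Finset.card_le_univ _).trans (by rw [Fintype.card_fin])
  let wκ : κ → ℕ := uqWeight N cA h
  let d : κ → ℕ := fun k => wκ k * N k
  let kOf : Finset (Fin h) × Finset (Fin h) → κ → Prop := fun α k => ακ k = α
  let P : Finset (Fin h) × Finset (Fin h) → Finset (Fin h) := fun α => if hα : ∃ k, kOf α k then Af hα.choose \ ρ hα.choose else ∅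
  let Q : Finset (Fin h) × Finset (Fin h) → Finset (Fin h) := fun α => if hα : ∃ k, kOf α k then Bf hα.choose \ Fk hα.choose else ∅
  let wt : Finset (Fin h) × Finset (Fin h) → ℕ := fun α => if hα : ∃ k, kOf α k then wκ hα.choose else 0
  have hchoose : ∀ k (hα : ∃ k', kOf (ακ k) k'), hα.choose = k := fun k hα => hαinj hα.choose_spec
  have hPk : ∀ k, P (ακ k) = Af k \ ρ k := fun k => by
    have hα : ∃ k', kOf (ακ k) k' := ⟨k, rfl⟩
    simp only [P, dif_pos hα, hchoose k hα]
  have hQk : ∀ k, Q (ακ k) = Bf k \ Fk k := fun k => by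
    have hα : ∃ k', kOf (ακ k) k' := ⟨k, rfl⟩
    simp only [Q, dif_pos hα, hchoose k hα]
  have hwtk : ∀ k, wt (ακ k) = wκ k := fun k => by
    have hα : ∃ k', kOf (ακ k) k' := ⟨k, rfl⟩
    simp only [wt, dif_pos hα, hchoose k hα]
  have hP : ∀ α ∈ 𝔅, P α ⊆ univ \ α.1 := by
    intro α hα
    obtain ⟨k, rfl⟩ := hmem𝔅.mp hα
    rw [hPk]
    intro x hx
    rw [Finset.mem_sdiff] at hx ⊢
    exact ⟨Finset.mem_univ _, hx.2⟩
  have hQ : ∀ α ∈ 𝔅, Q α ⊆ univ \ α.2 := by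
    intro α hα
    obtain ⟨k, rfl⟩ := hmem𝔅.mp hα
    rw [hQk]
    intro x hx
    rw [Finset.mem_sdiff] at hx ⊢
    exact ⟨Finset.mem_univ _, hx.2⟩
  have hρA : ∀ k, ρ k ∪ (Af k \ ρ k) = Af k := fun k => Finset.union_sdiff_of_subset (hρ k).1
  have hFB : ∀ k, Fk k ∪ (Bf k \ Fk k) = Bf k := fun k => Finset.union_sdiff_of_subset (hFk k).2.1
  have hNk : ∀ k, (P (ακ k)).card + (Q (ακ k)).card + 1 = N k := fun k => by rw [hPk, hQk]
  -- the specialisation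
  let f := wSpecHom 𝔅 P Q wt
  let G' : Matrix (Fin r) (Fin r) (Polynomial (MvPolynomial (Param h) ℂ)) := G.map f
  -- (E0) entries of G' off the deletion × F-columns block are constants
  have hG'C : ∀ i j, ¬ (a ∉ u i ∧ F ⊆ w j) → G' i j = Polynomial.C (G i j) := by
    intro i j hij
    show f (facePeelMatrix s h r u w a c D i j) = Polynomial.C (facePeelMatrix s h r u w a c D i j)
    by_cases hi : a ∈ u i
    · by_cases hj : F ⊆ w j
      · rw [facePeelMatrix_link_of_mem u w a c D hi hj]
        exact wSpecHom_coeff_eq_C' h𝔅 hFne h2 hP hQ _ _ (fun h2' => (Finset.mem_sdiff.mp (h2' hcF)).2 hcF)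
      · rw [facePeelMatrix_link_of_not_mem u w a c D hi hj, map_zero, map_zero]
    · have hj : ¬ (F ⊆ w j) := fun hj => hij ⟨hi, hj⟩
      rw [facePeelMatrix_del u w a c D hi j]
      exact wSpecHom_coeff_eq_C' h𝔅 hFne h2 hP hQ _ _ hj
  -- (E1) weighted degree analysis of a fitting term in a row whose face avoids full deleted faces other than those inside `Af k`
  -- key combinatorial fact: for a deletion row `i` in the support of `ν_k` (kept or `= iκ k`), every fitting triple has degree ≤ d k,
  -- with equality only for `(ακ k, P, Q)` at `i = iκ k`.
  have hfit : ∀ (k : κ) (i : Fin r), (∀ t, Af t ⊆ u i → i = iκ k) →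
      ∀ α ∈ 𝔅, ∀ Z ⊆ P α, ∀ W ⊆ Q α, α.1 ∪ Z ⊆ u i →
        wt α * (Z.card + W.card + 1) ≤ d k ∧
          (wt α * (Z.card + W.card + 1) = d k → i = iκ k ∧ α = ακ k ∧ Z = P (ακ k) ∧ W = Q (ακ k)) := by
    intro k i hi α hα Z hZ W hW hZS
    obtain ⟨t, rfl⟩ := hmem𝔅.mp hα
    rw [hwtk]
    rw [hPk] at hZ; rw [hQk] at hW
    by_cases hfull : Z = Af t \ ρ t ∧ W = Bf t \ Fk t
    · -- full twist sets: the face Af t sits inside u i, so i = iκ k and Af t ⊆ Af k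
      obtain ⟨rfl, rfl⟩ := hfull
      have hAt : Af t ⊆ u i := by rw [← hρA t]; exact hZS
      have hik : i = iκ k := hi t hAt
      subst hik
      have hcard : (Af t \ ρ t).card + (Bf t \ Fk t).card + 1 = N t := rfl
      rw [hcard]
      by_cases htk : t = k
      · subst htk
        exact ⟨le_rfl, fun _ => ⟨rfl, rfl, (hPk t).symm, (hQk t).symm⟩⟩
      · have hne : Af t ≠ Af k := fun h' => htk (hAinj h')
        have hlt : cA t < cA k := Finset.card_lt_card (lt_of_le_of_ne hAt hne)
        have := uqWeight_lt_of_lt (N := N) (cA := cA) (hmax := h) hN hlt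
        exact ⟨le_of_lt this, fun h' => absurd h' (ne_of_lt this)⟩
    · -- partial twist sets: at least one weight lost
      have hlt : Z.card + W.card + 1 < N t := by
        have hZ' := Finset.card_le_card hZ
        have hW' := Finset.card_le_card hW
        rcases not_and_or.mp hfull with hZne | hWne
        · have := Finset.card_lt_card (lt_of_le_of_ne hZ hZne)
          show Z.card + W.card + 1 < (Af t \ ρ t).card + (Bf t \ Fk t).card + 1
          omega
        · have := Finset.card_lt_card (lt_of_le_of_ne hW hWne)
          show Z.card + W.card + 1 < (Af t \ ρ t).card + (Bf t \ Fk t).card + 1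
          omega
      have := uqWeight_mul_lt (N := N) (cA := cA) (hmax := h) hN hcA k hlt
      exact ⟨le_of_lt this, fun h' => absurd h' (ne_of_lt this)⟩
  -- (E2) kept rows: degree < d k; deleted row iκ k: degree ≤ d k with top coefficient [w j = Bf k]
  have hkept_fit : ∀ (k : κ) (x : Fin n), ∀ t, Af t ⊆ u (e.symm (Sum.inl x)).1 → (e.symm (Sum.inl x)).1 = iκ k :=
    fun k x t ht => absurd ht (hup t x)
  have hdel_fit : ∀ (k : κ), ∀ t, Af t ⊆ u (iκ k) → iκ k = iκ k := fun _ _ _ => rfl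
  have hdeg : ∀ (k : κ) (i : Fin r), (∀ t, Af t ⊆ u i → i = iκ k) → a ∉ u i → ∀ j, (G' i j).natDegree ≤ d k := by
    intro k i hi hai j
    by_cases hj : F ⊆ w j
    · show (f (facePeelMatrix s h r u w a c D i j)).natDegree ≤ d k
      rw [facePeelMatrix_del u w a c D hai j]
      exact natDegree_wSpecHom_coeff_le' h𝔅 hFne h2 hP hQ _ _ (d k)
        (fun α hα Z hZ W hW hZS _ => (hfit k i hi α hα Z hZ W hW hZS).1)
    · rw [hG'C i j (fun h' => hj h'.2), Polynomial.natDegree_C]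
      exact Nat.zero_le _
  have hcoeff_kept : ∀ (k : κ) (x : Fin n) (j : Fin r), (G' (e.symm (Sum.inl x)).1 j).coeff (d k) = 0 := by
    intro k x j
    have hdpos : 0 < d k := uqWeight_mul_pos (N := N) (cA := cA) (hmax := h) hN k
    by_cases hj : F ⊆ w j
    · show (f (facePeelMatrix s h r u w a c D (e.symm (Sum.inl x)).1 j)).coeff (d k) = 0
      rw [facePeelMatrix_del u w a c D (e.symm (Sum.inl x)).2 j]
      refine Polynomial.coeff_eq_zero_of_natDegree_lt (Nat.lt_of_le_pred hdpos ?_)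
      refine natDegree_wSpecHom_coeff_le' h𝔅 hFne h2 hP hQ _ _ (d k - 1) (fun α hα Z hZ W hW hZS _ => ?_)
      have h' := hfit k _ (hkept_fit k x) α hα Z hZ W hW hZS
      have hne : wt α * (Z.card + W.card + 1) ≠ d k := fun heq => by
        have := (h'.2 heq).1
        exact hup k x (by
          show Af k ⊆ u (e.symm (Sum.inl x)).1
          rw [this])
      omega
    · rw [hG'C _ j (fun h' => hj h'.2), Polynomial.coeff_C, if_neg (Nat.pos_iff_ne_zero.mp hdpos)]
  have hcoeff_del : ∀ (k : κ) (j : Fin r), (G' (iκ k) j).coeff (d k) = if j = jκ k then 1 else 0 := by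
    intro k j
    have hdpos : 0 < d k := uqWeight_mul_pos (N := N) (cA := cA) (hmax := h) hN k
    by_cases hj : F ⊆ w j
    · show (f (facePeelMatrix s h r u w a c D (iκ k) j)).coeff (d k) = _
      rw [facePeelMatrix_del u w a c D (hiκ k) j,
        coeff_wSpecHom_coeff_top' h𝔅 hFne h2 hP hQ _ _ (Nat.pos_iff_ne_zero.mp hdpos) (hακ𝔅 k) (by rw [hNk, hwtk])
          (fun α hα Z hZ W hW hZS _ hd => ((hfit k (iκ k) (hdel_fit k) α hα Z hZ W hW hZS).2 hd).2),
        hPk, hQk, hρA, hFB]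
      show (if Af k ⊆ Af k ∧ Bf k ⊆ w j then restSetEntry s h 𝔅 (Af k \ Af k) (w j \ Bf k) else 0) = _
      rw [Finset.sdiff_self, restSetEntry_empty]
      by_cases hjk : j = jκ k
      · subst hjk
        rw [if_pos ⟨subset_rfl, subset_rfl⟩, if_pos rfl, Finset.sdiff_self, if_pos rfl]
      · rw [if_neg hjk]
        by_cases hB : Bf k ⊆ w j
        · rw [if_pos ⟨subset_rfl, hB⟩, if_neg]
          intro h0
          exact hjk (hw (Finset.Subset.antisymm (Finset.sdiff_eq_empty_iff_subset.mp h0) hB))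
        · rw [if_neg (fun h' => hB h'.2)]
    · rw [hG'C _ j (fun h' => hj h'.2), Polynomial.coeff_C, if_neg (Nat.pos_iff_ne_zero.mp hdpos), if_neg]
      rintro rfl
      exact hj (hjκ k)
  -- (F) the two kept blocks (of G and of G') and the two cofactor families
  have hK1₀ : blockKept G p q e eQ = Matrix.of fun x y : Fin n =>
      coeff (pexpo (u (e.symm (Sum.inl x)).1) (w (eQ.symm y).1)) (symbolicWitness s h) := by
    refine Matrix.ext (fun x y => ?_)
    show facePeelMatrix s h r u w a c D _ _ = _
    rw [facePeelMatrix_del u w a c D (e.symm (Sum.inl x)).2, Matrix.of_apply]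
  have hK1₀det : (blockKept G p q e eQ).det ≠ 0 := by rw [hK1₀]; exact H1
  have hK1map : blockKept G' p q e eQ = (blockKept G p q e eQ).map Polynomial.C := by
    refine Matrix.ext (fun x y => ?_)
    show G' (e.symm (Sum.inl x)).1 (eQ.symm y).1 = Polynomial.C (G (e.symm (Sum.inl x)).1 (eQ.symm y).1)
    exact hG'C _ _ (fun h' => (eQ.symm y).2 h'.2)
  have hK1det : (blockKept G' p q e eQ).det ≠ 0 := by
    rw [hK1map, ← RingHom.mapMatrix_apply, ← RingHom.map_det]
    exact fun h0 => hK1₀det (Polynomial.C_eq_zero.mp h0)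
  have hK2₀ : blockKept G.transpose q p e' eP = (Matrix.of fun x y : Fin n' =>
      coeff (pexpo ((u (eP.symm x).1).erase a) (w (e'.symm (Sum.inl y)).1 \ insert c D)) (symbolicWitness s h)).transpose := by
    refine Matrix.ext (fun x y => ?_)
    show facePeelMatrix s h r u w a c D (eP.symm y).1 (e'.symm (Sum.inl x)).1 = _
    rw [facePeelMatrix_link_of_mem u w a c D (eP.symm y).2 (not_not.mp (e'.symm (Sum.inl x)).2), Matrix.transpose_apply,
      Matrix.of_apply]
  have hK2₀det : (blockKept G.transpose q p e' eP).det ≠ 0 := by rw [hK2₀, Matrix.det_transpose]; exact H2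
  have hK2map : blockKept G'.transpose q p e' eP = (blockKept G.transpose q p e' eP).map Polynomial.C := by
    refine Matrix.ext (fun x y => ?_)
    show G' (eP.symm y).1 (e'.symm (Sum.inl x)).1 = Polynomial.C (G (eP.symm y).1 (e'.symm (Sum.inl x)).1)
    exact hG'C _ _ (fun h' => h'.1 (eP.symm y).2)
  have hK2det : (blockKept G'.transpose q p e' eP).det ≠ 0 := by
    rw [hK2map, ← RingHom.mapMatrix_apply, ← RingHom.map_det]
    exact fun h0 => hK2₀det (Polynomial.C_eq_zero.mp h0)
  let ν : κ → Fin r → Polynomial (MvPolynomial (Param h) ℂ) := fun k => blockCofactorFamily G' p q e eQ k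
  let β : κ → Fin r → Polynomial (MvPolynomial (Param h) ℂ) := fun l => blockCofactorFamily G'.transpose q p e' eP l
  let ν₀ : κ → Fin r → MvPolynomial (Param h) ℂ := fun k => blockCofactorFamily G p q e eQ k
  let β₀ : κ → Fin r → MvPolynomial (Param h) ℂ := fun l => blockCofactorFamily G.transpose q p e' eP l
  have hνC : ∀ k i, ν k i = Polynomial.C (ν₀ k i) := fun k i =>
    blockCofactorFamily_map Polynomial.C G G' p q e eQ (fun i j hi hj => hG'C i j (fun h' => hj h'.2)) k i
  have hG'Ct : ∀ j i, ¬ q j → p i → G'.transpose j i = Polynomial.C (G.transpose j i) := fun j i _ hi => by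
    show G' i j = Polynomial.C (G i j)
    exact hG'C i j (fun h' => h'.1 hi)
  have hβC : ∀ l j, β l j = Polynomial.C (β₀ l j) := fun l j =>
    blockCofactorFamily_map Polynomial.C G.transpose G'.transpose q p e' eP hG'Ct l j
  -- values of the families at deleted rows / columns
  have hν₀del : ∀ k k', ν₀ k (iκ k') = if k' = k then (-1) ^ n * (blockKept G p q e eQ).det else 0 := fun k k' =>
    blockCofactorFamily_deleted G p q e eQ k k'
  have hβ₀del : ∀ l l', β₀ l (jκ l') = if l' = l then (-1) ^ n' * (blockKept G.transpose q p e' eP).det else 0 := fun l l' =>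
    blockCofactorFamily_deleted G.transpose q p e' eP l l'
  -- support of ν k among deletion rows: kept rows or iκ k
  have hνsupp : ∀ k i, ν k i ≠ 0 → (∃ x, i = (e.symm (Sum.inl x)).1) ∨ i = iκ k := by
    intro k i hne
    by_cases hi : p i
    · exact absurd (blockCofactorFamily_of_pos G' p q e eQ k hi) hne
    · rcases hx : e ⟨i, hi⟩ with x | k'
      · left; refine ⟨x, ?_⟩
        have := congrArg (fun z => (e.symm z).1) hx
        simpa using this
      · right
        have hi' : i = iκ k' := by
          have := congrArg (fun z => (e.symm z).1) hx
          simpa using this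
        rw [hi', hνC, hν₀del] at hne
        by_cases hk : k' = k
        · rw [hi', hk]
        · exact absurd (by rw [if_neg hk, map_zero]) hne
  -- (G) the cross matrix: degrees and top coefficients
  let Pm : Matrix κ κ (Polynomial (MvPolynomial (Param h) ℂ)) := Matrix.of fun k l => ν k ⬝ᵥ (G' *ᵥ β l)
  have hPm_apply : ∀ k l, Pm k l = ∑ i, ∑ j, ν k i * G' i j * β l j := fun k l => by
    show (Matrix.of fun k l => ν k ⬝ᵥ (G' *ᵥ β l)) k l = _
    rw [Matrix.of_apply]
    exact dotProduct_mulVec_eq_sum_sum _ _ _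
  have hrow : ∀ k l, (Pm k l).natDegree ≤ d k ∧ (Pm k l).coeff (d k) = ν₀ k (iκ k) * β₀ l (jκ k) := by
    intro k l
    rw [hPm_apply]
    -- termwise facts
    have hterm : ∀ i j, (ν k i * G' i j * β l j).natDegree ≤ d k ∧
        (ν k i * G' i j * β l j).coeff (d k) = if i = iκ k ∧ j = jκ k then ν₀ k i * β₀ l j else 0 := by
      intro i j
      rw [hνC, hβC]
      by_cases hν0 : ν k i = 0
      · rw [hνC] at hν0
        rw [hν0, zero_mul, zero_mul, Polynomial.natDegree_zero, Polynomial.coeff_zero]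
        refine ⟨Nat.zero_le _, ?_⟩
        split_ifs
        · rw [Polynomial.C_eq_zero.mp hν0, zero_mul]
        · rfl
      rcases hνsupp k i hν0 with ⟨x, rfl⟩ | rfl
      · refine ⟨(Polynomial.natDegree_mul_C_le _ _).trans ((Polynomial.natDegree_C_mul_le _ _).trans
          (hdeg k _ (hkept_fit k x) (e.symm (Sum.inl x)).2 j)), ?_⟩
        rw [Polynomial.coeff_mul_C, Polynomial.coeff_C_mul, hcoeff_kept, mul_zero, zero_mul, if_neg]
        rintro ⟨hx, -⟩
        exact hup k x (by show Af k ⊆ u (e.symm (Sum.inl x)).1; rw [hx])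
      · refine ⟨(Polynomial.natDegree_mul_C_le _ _).trans ((Polynomial.natDegree_C_mul_le _ _).trans
          (hdeg k _ (hdel_fit k) (hiκ k) j)), ?_⟩
        rw [Polynomial.coeff_mul_C, Polynomial.coeff_C_mul, hcoeff_del]
        by_cases hj : j = jκ k
        · rw [if_pos hj, if_pos ⟨rfl, hj⟩, mul_one]
        · rw [if_neg hj, if_neg (fun h' => hj h'.2), mul_zero, zero_mul]
    refine ⟨Polynomial.natDegree_sum_le_of_forall_le _ _ (fun i _ =>
      Polynomial.natDegree_sum_le_of_forall_le _ _ (fun j _ => (hterm i j).1)), ?_⟩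
    rw [Polynomial.finsetSum_coeff, Finset.sum_eq_single (iκ k)]
    · rw [Polynomial.finsetSum_coeff, Finset.sum_eq_single (jκ k)]
      · rw [(hterm _ _).2, if_pos ⟨rfl, rfl⟩]
      · intro j _ hj; rw [(hterm _ _).2, if_neg (fun h' => hj h'.2)]
      · intro h'; exact absurd (Finset.mem_univ _) h'
    · intro i _ hi
      rw [Polynomial.finsetSum_coeff]
      exact Finset.sum_eq_zero (fun j _ => by rw [(hterm _ _).2, if_neg (fun h' => hi h'.1)])
    · intro h'; exact absurd (Finset.mem_univ _) h'
  have hPdet : Pm.det ≠ 0 := by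
    have htop := coeff_det_of_natDegree_le_row Pm d (fun k l => (hrow k l).1)
    have hdiag : (Matrix.of fun k l => (Pm k l).coeff (d k)) =
        Matrix.diagonal (fun k => ν₀ k (iκ k) * β₀ k (jκ k)) := by
      refine Matrix.ext (fun k l => ?_)
      rw [Matrix.of_apply, (hrow k l).2, hβ₀del]
      by_cases hkl : k = l
      · subst hkl; rw [Matrix.diagonal_apply_eq, hβ₀del, if_pos rfl]
      · rw [Matrix.diagonal_apply_ne _ hkl, if_neg hkl, mul_zero]
    rw [hdiag, Matrix.det_diagonal] at htop
    intro h0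
    rw [h0, Polynomial.coeff_zero] at htop
    refine (Finset.prod_ne_zero_iff.mpr (fun k _ => ?_)) htop.symm
    rw [hν₀del, hβ₀del, if_pos rfl, if_pos rfl]
    exact mul_ne_zero (mul_ne_zero (pow_ne_zero _ (by norm_num)) hK1₀det) (mul_ne_zero (pow_ne_zero _ (by norm_num)) hK2₀det)
  -- (H) block pairing with bases
  have hdetG' : G'.det ≠ 0 := by
    refine det_ne_zero_of_blockPairing_basis G' p q (fun i j hi hj => ?_) ?_ ν
      (fun x hxp hxq => blockCofactorFamily_span G' p q e eQ hK1det x hxp hxq) β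
      (fun l j hj => blockCofactorFamily_of_pos G'.transpose q p e' eP l hj)
      (fun l i hi => by rw [← Matrix.vecMul_transpose]; exact blockCofactorFamily_vecMul_of_pos G'.transpose q p e' eP l hi) hPdet
    · show f (facePeelMatrix s h r u w a c D i j) = 0
      rw [facePeelMatrix_link_of_not_mem u w a c D hi hj, map_zero]
    · -- the link rows are independent: restrict to the kept F-columns
      exact fun z hz hzS => vecMul_eq_zero_of_blockKept_transpose G' p q e' eP hK2det z hz hzS
  -- (I) conclude
  have hdetG : G.det ≠ 0 := by
    intro h0
    apply hdetG'
    show (G.map f).det = 0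
    rw [← RingHom.mapMatrix_apply, ← RingHom.map_det, h0, map_zero]
  exact symbolicDet_ne_zero_of_facePeel_genDet hs u w a c D hcD hdetG

end

end Summit.ValiantsHypothesis.ValiantsHypothesis.Theorems.BarrierLever.AnchoredPeeling
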